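import Literature.RingTheory.OrderOfVanishing.NormOrd
import Mathlib.RingTheory.Localization.AtPrime.Extension
import Mathlib.RingTheory.Localization.LocalizationLocalization
import HarnessLib

/-!
# `ord_{R_𝔭}(Nm b) = Σ_{𝔮 ∣ 𝔭} [κ(𝔮):κ(𝔭)] ord_{S_𝔮}(b)` along a finite extension (Stacks 02MJ)

Stacks, Algebra, Lemma 10.121.8 (Tag 02MJ;
`Literature.RingTheory.OrderOfVanishing.ordFrac_norm_algebraMap`) is stated for a finite extension
`A ⊆ B` of domains with `A` local.  In the geometric application (Stacks Tag 02RT, proper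
push-forward of principal divisors) one has instead a finite extension `R ⊆ S` of domains (the
coordinate rings of an affine open and of its preimage under a finite morphism) and a prime `𝔭`
of `R` of height one, and applies 02MJ to `A = R_𝔭 ⊆ B = S_𝔭`.  This file carries out that
localisation once and for all and proves

* `Literature.RingTheory.OrderOfVanishing.ordFrac_norm_eq_finsum_primesOver`: for `b ∈ S ∖ 0`,
  `ord_{R_𝔭}(Nm_{L/K} b) = Σ_{𝔮 ∣ 𝔭} [κ(𝔮) : κ(𝔭)] · ord_{S_𝔮}(b)`, the sum over the primes `𝔮`
  of `S` over `𝔭`, with Mathlib's `Ring.ordFrac`, `Ideal.inertiaDeg`, `Ring.ord`;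

together with the transport lemmas it rests on: `Ring.ord`/`Ring.ordFrac` are invariant under
ring isomorphisms (`Literature.RingTheory.OrderOfVanishing.ord_ringEquiv`,
`Literature.RingTheory.OrderOfVanishing.ordFrac_eq_of_ringEquiv` — used later to pass between
local rings of schemes and localisations of coordinate rings), the maximal ideals of `S_𝔭` are the
`𝔮S_𝔭` (`Literature.RingTheory.OrderOfVanishing.isMaximal_map`), `(S_𝔭)_{𝔮S_𝔭} = S_𝔮`
(`Literature.RingTheory.OrderOfVanishing.ord_localization_map`) and
`[κ(𝔮S_𝔭) : κ(𝔭R_𝔭)] = [κ(𝔮) : κ(𝔭)]`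
(`Literature.RingTheory.OrderOfVanishing.inertiaDeg_map`, both being
`[Frac(S/𝔮) : Frac(R/𝔭)]`).  Everything here is proved; there are no definitions and no named
facts.  As in Mathlib's `RingTheory/Localization/AtPrime/Extension.lean`, `Rₚ` and `Sₚ` are
arbitrary localisations (`IsLocalization`), so that the result applies verbatim to local rings of
schemes.

## References

* [StacksProject] The Stacks Project, Algebra, Lemma 10.121.8 (Tag 02MJ); Chow Homology,
  Lemma 42.18.1 (Tag 02RT), proof.
* [Fulton1998] W. Fulton, *Intersection Theory*, 2nd ed. (1998), Prop. 1.4 (b), Case 2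
  ("`A` is the localization of `Γ` at the prime ideal corresponding to `W`, and `B = Λ ⊗_Γ A`").
-/

open Module IsLocalRing

noncomputable section

namespace Literature.RingTheory.OrderOfVanishing

/-! ### Transport of orders of vanishing along ring isomorphisms -/

section Transport

/-- `ord` is invariant under ring isomorphisms: `ord_Q(e x) = ord_P(x)`. [folklore] -/
theorem ord_ringEquiv {P Q : Type*} [CommRing P] [CommRing Q] (e : P ≃+* Q) (x : P) :
    Ring.ord Q (e x) = Ring.ord P x := by
  letI : Algebra P Q := e.toRingHom.toAlgebra
  have h1 : Module.length P (Q ⧸ Ideal.span {e x}) = Module.length Q (Q ⧸ Ideal.span {e x}) :=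
    Module.length_eq_of_surjective (R := Q) (S := P) (M := Q ⧸ Ideal.span {e x}) e.surjective
  rw [Ring.ord, Ring.ord, ← h1]
  have hmap : (Ideal.span {x}).map e.toRingHom = Ideal.span {e x} := by
    rw [Ideal.map_span, Set.image_singleton]; rfl
  -- `P / (x) ≃ₗ[P] Q / (e x)` via `e`
  let f : P ≃ₗ[P] Q :=
    { e.toAddEquiv with
      map_smul' := fun p q ↦ by
        change e (p * q) = e p * e q
        rw [map_mul] }
  have hf : Submodule.map f.toLinearMap ((Ideal.span {x}).restrictScalars P) =
      (Ideal.span {e x}).restrictScalars P := by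
    ext y
    simp only [Submodule.mem_map, Submodule.restrictScalars_mem, LinearEquiv.coe_toLinearMap]
    constructor
    · rintro ⟨z, hz, rfl⟩
      obtain ⟨c, rfl⟩ := Ideal.mem_span_singleton'.mp hz
      exact Ideal.mem_span_singleton'.mpr ⟨e c, by change e c * e x = e (c * x); rw [map_mul]⟩
    · intro hy
      obtain ⟨c, rfl⟩ := Ideal.mem_span_singleton'.mp hy
      refine ⟨e.symm c * x, Ideal.mem_span_singleton'.mpr ⟨e.symm c, rfl⟩, ?_⟩
      change e (e.symm c * x) = c * e x
      rw [map_mul, RingEquiv.apply_symm_apply]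
  rw [← (Submodule.Quotient.restrictScalarsEquiv P (Ideal.span {x})).length_eq,
    (Submodule.Quotient.equiv _ _ f hf).length_eq,
    (Submodule.Quotient.restrictScalarsEquiv P (Ideal.span {e x})).length_eq]

/-- `ordMonoidWithZeroHom` is invariant under ring isomorphisms of domains. [folklore] -/
theorem ordMonoidWithZeroHom_ringEquiv {P Q : Type*} [CommRing P] [IsDomain P] [CommRing Q]
    [IsDomain Q] (e : P ≃+* Q) (x : P) :
    Ring.ordMonoidWithZeroHom Q (e x) = Ring.ordMonoidWithZeroHom P x := by
  by_cases hx : x = 0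
  · subst hx; simp
  · rw [Ring.ordMonoidWithZeroHom_eq_ord (mem_nonZeroDivisors_of_ne_zero hx),
      Ring.ordMonoidWithZeroHom_eq_ord (mem_nonZeroDivisors_of_ne_zero
        ((map_ne_zero_iff _ e.injective).mpr hx)), ord_ringEquiv]

/-- **`ord_A : K^* → ℤ` depends only on the subring `A ⊆ K` up to isomorphism**: for Noetherian
domains `A ≅ A'` of dimension `≤ 1` with the same fraction field `K` (compatibly with the
isomorphism), `Ring.ordFrac A = Ring.ordFrac A'` on `K`. Used to pass between a local ring of a
scheme and the localisation of an affine coordinate ring. [folklore] -/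
theorem ordFrac_eq_of_ringEquiv {A A' K : Type*} [CommRing A] [IsDomain A] [IsNoetherianRing A]
    [Ring.KrullDimLE 1 A] [CommRing A'] [IsDomain A'] [IsNoetherianRing A'] [Ring.KrullDimLE 1 A']
    [Field K] [Algebra A K] [IsFractionRing A K] [Algebra A' K] [IsFractionRing A' K]
    (e : A ≃+* A') (he : ∀ a, algebraMap A' K (e a) = algebraMap A K a) (z : K) :
    Ring.ordFrac A z = Ring.ordFrac A' z := by
  obtain ⟨a, b, hb, rfl⟩ := IsFractionRing.div_surjective (A := A) z
  by_cases ha : a = 0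
  · subst ha; simp
  have hb0 : b ≠ 0 := nonZeroDivisors.ne_zero hb
  rw [map_div₀, map_div₀, Ring.ordFrac_eq_ord A ha, Ring.ordFrac_eq_ord A hb0, ← he a, ← he b,
    Ring.ordFrac_eq_ord A' ((map_ne_zero_iff _ e.injective).mpr ha),
    Ring.ordFrac_eq_ord A' ((map_ne_zero_iff _ e.injective).mpr hb0),
    ordMonoidWithZeroHom_ringEquiv, ordMonoidWithZeroHom_ringEquiv]

end Transport

/-! ### The localised extension `R_𝔭 ⊆ S_𝔭` of a finite extension `R ⊆ S`

As in Mathlib's `Mathlib/RingTheory/Localization/AtPrime/Extension.lean`, `Rₚ` and `Sₚ` are any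
localisations of `R` at `𝔭` and of `S` at the image of `R ∖ 𝔭`. -/

section Extension

variable {R S : Type*} [CommRing R] [CommRing S] [Algebra R S] (p : Ideal R) [p.IsPrime]
  (Rₚ Sₚ : Type*) [CommRing Rₚ] [CommRing Sₚ] [Algebra R Rₚ] [IsLocalization.AtPrime Rₚ p]
  [IsLocalRing Rₚ] [Algebra S Sₚ] [IsLocalization (Algebra.algebraMapSubmonoid S p.primeCompl) Sₚ]
  [Algebra Rₚ Sₚ] [Algebra R Sₚ] [IsScalarTower R S Sₚ] [IsScalarTower R Rₚ Sₚ]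

omit [Algebra R Sₚ] [IsScalarTower R S Sₚ] in
/-- For a prime `𝔮` of `S` over `𝔭`, the localisation of `S_𝔭` at `𝔮 S_𝔭` is the localisation of
`S` at `𝔮`; hence `ord_{(S_𝔭)_{𝔮S_𝔭}}(b) = ord_{S_𝔮}(b)`. [folklore] -/
theorem ord_localization_map (q : Ideal S) [q.IsPrime] [q.LiesOver p]
    [(q.map (algebraMap S Sₚ)).IsPrime] (b : S) :
    Ring.ord (Localization.AtPrime (q.map (algebraMap S Sₚ)))
        (algebraMap S (Localization.AtPrime (q.map (algebraMap S Sₚ))) b) =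
      Ring.ord (Localization.AtPrime q) (algebraMap S (Localization.AtPrime q) b) := by
  -- `(S_𝔭)_{𝔮S_𝔭}` is a localisation of `S` at `𝔮`
  haveI : IsLocalization.AtPrime (Localization.AtPrime (q.map (algebraMap S Sₚ))) q := by
    convert IsLocalization.isLocalization_isLocalization_atPrime_isLocalization
      (Algebra.algebraMapSubmonoid S p.primeCompl) (Localization.AtPrime (q.map (algebraMap S Sₚ)))
      (q.map (algebraMap S Sₚ))
    exact (IsLocalization.under_map_of_isPrime_disjoint
      (Algebra.algebraMapSubmonoid S p.primeCompl) Sₚ inferInstance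
      (Ideal.disjoint_primeCompl_of_liesOver q p)).symm
  rw [← ord_ringEquiv (Localization.algEquiv q.primeCompl
    (Localization.AtPrime (q.map (algebraMap S Sₚ)))).toRingEquiv]
  congr 1
  change _ = Localization.algEquiv q.primeCompl (Localization.AtPrime (q.map (algebraMap S Sₚ)))
    (algebraMap S (Localization.AtPrime q) b)
  rw [AlgEquiv.commutes, IsScalarTower.algebraMap_apply S Sₚ]

include Rₚ in
/-- For a prime `𝔮` of `S` over `𝔭`, `S` finite over `R`, `𝔮 S_𝔭` is a maximal ideal of `S_𝔭` (it
lies over the maximal ideal of `R_𝔭` and `S_𝔭` is finite over `R_𝔭`). [folklore] -/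
theorem isMaximal_map [Module.Finite R S] (q : Ideal S) [q.IsPrime] [q.LiesOver p] :
    (q.map (algebraMap S Sₚ)).IsMaximal := by
  haveI : Module.Finite Rₚ Sₚ := Module.Finite.of_isLocalization R S p.primeCompl
  haveI : Algebra.IsIntegral Rₚ Sₚ := Algebra.IsIntegral.of_finite Rₚ Sₚ
  haveI := IsLocalization.AtPrime.isPrime_map_of_liesOver S p Sₚ q
  haveI := IsLocalization.AtPrime.liesOver_map_of_liesOver p Rₚ Sₚ q
  refine Ideal.isMaximal_of_isIntegral_of_isMaximal_comap (R := Rₚ) _ ?_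
  rw [← Ideal.under_def,
    ← Ideal.LiesOver.over (p := maximalIdeal Rₚ) (P := q.map (algebraMap S Sₚ))]
  exact IsLocalRing.maximalIdeal.isMaximal Rₚ

omit [Algebra R Sₚ] [IsScalarTower R S Sₚ] in
/-- `S/𝔮 → S_𝔭/𝔮S_𝔭` exhibits the field `S_𝔭/𝔮S_𝔭` as the fraction field of `S/𝔮`, for `𝔮`
over `𝔭`. [folklore] -/
theorem isFractionRing_quotient_map (q : Ideal S) [q.IsPrime] [q.LiesOver p]
    [(q.map (algebraMap S Sₚ)).IsMaximal] :
    IsFractionRing (S ⧸ q) (Sₚ ⧸ q.map (algebraMap S Sₚ)) := by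
  letI := Ideal.Quotient.field (q.map (algebraMap S Sₚ))
  have hq : (q.map (algebraMap S Sₚ)).comap (algebraMap S Sₚ) = q :=
    IsLocalization.under_map_of_isPrime_disjoint (Algebra.algebraMapSubmonoid S p.primeCompl)
      Sₚ inferInstance (Ideal.disjoint_primeCompl_of_liesOver q p)
  have hinj : Function.Injective (algebraMap (S ⧸ q) (Sₚ ⧸ q.map (algebraMap S Sₚ))) := by
    rw [injective_iff_map_eq_zero]
    intro x hx
    obtain ⟨x, rfl⟩ := Ideal.Quotient.mk_surjective x
    rw [Ideal.Quotient.algebraMap_quotient_map_quotient, Ideal.Quotient.eq_zero_iff_mem,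
      ← Ideal.mem_comap, hq] at hx
    exact Ideal.Quotient.eq_zero_iff_mem.mpr hx
  haveI : FaithfulSMul (S ⧸ q) (Sₚ ⧸ q.map (algebraMap S Sₚ)) :=
    (faithfulSMul_iff_algebraMap_injective _ _).mpr hinj
  refine IsFractionRing.of_field _ _ fun z ↦ ?_
  obtain ⟨z, rfl⟩ := Ideal.Quotient.mk_surjective z
  obtain ⟨⟨s, t⟩, rfl⟩ :=
    IsLocalization.mk'_surjective (Algebra.algebraMapSubmonoid S p.primeCompl) z
  refine ⟨Ideal.Quotient.mk q s, Ideal.Quotient.mk q t, ?_⟩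
  rw [Ideal.Quotient.algebraMap_quotient_map_quotient,
    Ideal.Quotient.algebraMap_quotient_map_quotient, eq_div_iff, ← map_mul, IsLocalization.mk'_spec]
  rw [Ne, Ideal.Quotient.eq_zero_iff_mem, ← Ideal.mem_comap, hq]
  exact fun h ↦ Set.disjoint_left.mp (Ideal.disjoint_primeCompl_of_liesOver q p) t.2 h

/-- `R/𝔭 → R_𝔭/𝔭R_𝔭` exhibits the residue field of `R_𝔭` as the fraction field of `R/𝔭`
(localisation preserves residue fields, Mathlib `IsLocalization.AtPrime.equivQuotMaximalIdeal`).
[folklore] -/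
theorem isFractionRing_quotient_maximalIdeal :
    IsFractionRing (R ⧸ p) (Rₚ ⧸ maximalIdeal Rₚ) := by
  letI := Ideal.Quotient.field (maximalIdeal Rₚ)
  have halg : ∀ x : R, algebraMap (R ⧸ p) (Rₚ ⧸ maximalIdeal Rₚ) (Ideal.Quotient.mk p x) =
      Ideal.Quotient.mk _ (algebraMap R Rₚ x) := fun x ↦ by
    rw [← Ideal.Quotient.algebraMap_eq, ← IsScalarTower.algebraMap_apply,
      IsScalarTower.algebraMap_apply R Rₚ (Rₚ ⧸ maximalIdeal Rₚ), Ideal.Quotient.algebraMap_eq]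
  have hinj : Function.Injective (algebraMap (R ⧸ p) (Rₚ ⧸ maximalIdeal Rₚ)) := by
    rw [injective_iff_map_eq_zero]
    intro x hx
    obtain ⟨x, rfl⟩ := Ideal.Quotient.mk_surjective x
    rw [halg, Ideal.Quotient.eq_zero_iff_mem,
      IsLocalization.AtPrime.to_map_mem_maximal_iff Rₚ p] at hx
    exact Ideal.Quotient.eq_zero_iff_mem.mpr hx
  haveI : FaithfulSMul (R ⧸ p) (Rₚ ⧸ maximalIdeal Rₚ) :=
    (faithfulSMul_iff_algebraMap_injective _ _).mpr hinj
  refine IsFractionRing.of_field _ _ fun z ↦ ?_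
  obtain ⟨z, rfl⟩ := Ideal.Quotient.mk_surjective z
  obtain ⟨⟨r, t⟩, rfl⟩ := IsLocalization.mk'_surjective p.primeCompl z
  refine ⟨Ideal.Quotient.mk p r, Ideal.Quotient.mk p t, ?_⟩
  rw [halg, halg, eq_div_iff, ← map_mul, IsLocalization.mk'_spec]
  rw [Ne, Ideal.Quotient.eq_zero_iff_mem, IsLocalization.AtPrime.to_map_mem_maximal_iff Rₚ p]
  exact t.2

/-- **Residue degrees are unchanged by localising the base**: `[κ(𝔮S_𝔭) : κ(𝔭R_𝔭)] = [κ(𝔮) : κ(𝔭)]`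
for `𝔮` over `𝔭` (both are the degree of `Frac(S/𝔮)` over `Frac(R/𝔭)`; Mathlib
`Ideal.inertiaDeg_eq_of_isFractionRing`). [folklore] -/
theorem inertiaDeg_map (q : Ideal S) [q.IsPrime] [q.LiesOver p]
    [(q.map (algebraMap S Sₚ)).IsMaximal] :
    (q.map (algebraMap S Sₚ)).inertiaDeg Rₚ = q.inertiaDeg R := by
  haveI := IsLocalization.AtPrime.liesOver_map_of_liesOver p Rₚ Sₚ q
  haveI := isFractionRing_quotient_map p Sₚ q
  haveI := isFractionRing_quotient_maximalIdeal p Rₚ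
  letI := Ideal.Quotient.field (q.map (algebraMap S Sₚ))
  letI := Ideal.Quotient.field (maximalIdeal Rₚ)
  haveI : IsScalarTower R (Rₚ ⧸ maximalIdeal Rₚ) (Sₚ ⧸ q.map (algebraMap S Sₚ)) := by
    refine IsScalarTower.of_algebraMap_eq fun r ↦ ?_
    rw [IsScalarTower.algebraMap_apply R Rₚ (Rₚ ⧸ maximalIdeal Rₚ),
      IsScalarTower.algebraMap_apply R Rₚ (Sₚ ⧸ q.map (algebraMap S Sₚ)),
      ← IsScalarTower.algebraMap_apply Rₚ (Rₚ ⧸ maximalIdeal Rₚ) (Sₚ ⧸ q.map (algebraMap S Sₚ))]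
  -- both residue degrees are the degree of `S_𝔭/𝔮S_𝔭` over `R_𝔭/𝔭R_𝔭`
  rw [Ideal.inertiaDeg_eq_of_isFractionRing (maximalIdeal Rₚ) (q.map (algebraMap S Sₚ))
      (Rₚ ⧸ maximalIdeal Rₚ) (Sₚ ⧸ q.map (algebraMap S Sₚ)),
    Ideal.inertiaDeg_eq_of_isFractionRing p q (Rₚ ⧸ maximalIdeal Rₚ) (Sₚ ⧸ q.map (algebraMap S Sₚ))]

include p in
omit [IsLocalRing Rₚ] in
/-- `R_𝔭 → S_𝔭` is injective when `R → S` is an injective map of domains. [folklore] -/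
theorem faithfulSMul_localization [IsDomain S] [FaithfulSMul R S] : FaithfulSMul Rₚ Sₚ := by
  haveI : IsDomain R := (FaithfulSMul.algebraMap_injective R S).isDomain (algebraMap R S)
  have hM : Algebra.algebraMapSubmonoid S p.primeCompl ≤ nonZeroDivisors S :=
    map_le_nonZeroDivisors_of_injective _ (FaithfulSMul.algebraMap_injective R S)
      p.primeCompl_le_nonZeroDivisors
  rw [faithfulSMul_iff_algebraMap_injective, injective_iff_map_eq_zero]
  intro x hx
  obtain ⟨⟨r, t⟩, rfl⟩ := IsLocalization.mk'_surjective p.primeCompl x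
  dsimp only at hx ⊢
  have h : algebraMap Rₚ Sₚ (algebraMap R Rₚ r) = 0 := by
    rw [← IsLocalization.mk'_spec Rₚ r t, map_mul, hx, zero_mul]
  rw [← IsScalarTower.algebraMap_apply, IsScalarTower.algebraMap_apply R S Sₚ,
    map_eq_zero_iff _ (IsLocalization.injective Sₚ hM),
    map_eq_zero_iff _ (FaithfulSMul.algebraMap_injective R S)] at h
  rw [h, IsLocalization.mk'_zero]

include Sₚ in
/-- **Stacks, Algebra, Lemma 10.121.8 (Tag 02MJ) along a finite extension `R ⊆ S` of domains**,
localised at a prime `𝔭` of `R` with `dim R_𝔭 ≤ 1`: for `b ∈ S ∖ 0`, with `K = Frac R ⊆ L = Frac S`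
(`L/K` finite),
`ord_{R_𝔭}(Nm_{L/K} b) = Σ_{𝔮 ∣ 𝔭} [κ(𝔮) : κ(𝔭)] · ord_{S_𝔮}(b)`,
the sum over the primes `𝔮` of `S` lying over `𝔭` (`[κ(𝔮) : κ(𝔭)]` = Mathlib `Ideal.inertiaDeg`,
`ord_{S_𝔮}(b) = ℓ(S_𝔮/bS_𝔮)` = Mathlib `Ring.ord`, `ord_{R_𝔭}` = Mathlib `Ring.ordFrac Rₚ` on
`K`, for any localisation `Rₚ` of `R` at `𝔭`, e.g. a local ring of a scheme). This is Tag 02MJ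
(`Literature.RingTheory.OrderOfVanishing.ordFrac_norm_algebraMap`) for the finite extension
`R_𝔭 ⊆ S_𝔭 = S ⊗_R R_𝔭`, whose maximal ideals are the `𝔮S_𝔭`, `𝔮 ∣ 𝔭`, with
`(S_𝔭)_{𝔮S_𝔭} = S_𝔮` and the same residue degrees; it is the form used for
`p_* div(f) = div(Nm f)` (Stacks Tag 02RT, proof: "The coefficient of `[Z]` in `p_* div_X(f)` is
`Σ_{𝔮 lying over 𝔭} [κ(𝔮):κ(𝔭)] ord_{A_𝔮}(f)`"). The auxiliary localisation `Sₚ` of `S` (any; e.g.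
`Localization (algebraMapSubmonoid S 𝔭.primeCompl)` with `localizationAlgebra`) does not appear
in the conclusion. [cite: StacksProject, Tag 02MJ] -/
theorem ordFrac_norm_eq_finsum_primesOver [IsDomain S] [IsNoetherianRing R] [Module.Finite R S]
    [FaithfulSMul R S] [IsNoetherianRing Rₚ] [Ring.KrullDimLE 1 Rₚ] {K L : Type*} [Field K]
    [Field L] [Algebra R K] [IsFractionRing R K] [Algebra S L] [IsFractionRing S L] [Algebra K L]
    [Algebra R L] [IsScalarTower R S L] [IsScalarTower R K L] [FiniteDimensional K L]
    [Algebra Rₚ K] [IsScalarTower R Rₚ K] [IsFractionRing Rₚ K] (b : S) (hb : b ≠ 0) :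
    Ring.ordFrac Rₚ (Algebra.norm K (algebraMap S L b)) =
      ((Multiplicative.ofAdd ((∑ᶠ q : p.primesOver S, (q.1.inertiaDeg R : ℕ∞) *
        Ring.ord (Localization.AtPrime q.1) (algebraMap S (Localization.AtPrime q.1) b)).toNat :
          ℤ) : Multiplicative ℤ) : WithZero (Multiplicative ℤ)) := by
  haveI : IsDomain R := (FaithfulSMul.algebraMap_injective R S).isDomain (algebraMap R S)
  haveI : Algebra.IsIntegral R S := Algebra.IsIntegral.of_finite R S
  have hM : Algebra.algebraMapSubmonoid S p.primeCompl ≤ nonZeroDivisors S :=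
    map_le_nonZeroDivisors_of_injective _ (FaithfulSMul.algebraMap_injective R S)
      p.primeCompl_le_nonZeroDivisors
  haveI : IsDomain Sₚ := IsLocalization.isDomain_of_le_nonZeroDivisors Sₚ hM
  haveI : IsDomain Rₚ :=
    IsLocalization.isDomain_of_le_nonZeroDivisors Rₚ p.primeCompl_le_nonZeroDivisors
  haveI : Module.Finite Rₚ Sₚ := Module.Finite.of_isLocalization R S p.primeCompl
  haveI : Algebra.IsIntegral Rₚ Sₚ := Algebra.IsIntegral.of_finite Rₚ Sₚ
  haveI : FaithfulSMul Rₚ Sₚ := faithfulSMul_localization (S := S) p Rₚ Sₚ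
  -- the `S_𝔭`-algebra structure on `L` and the towers
  have hunit : ∀ y : Algebra.algebraMapSubmonoid S p.primeCompl, IsUnit (algebraMap S L y) :=
    fun y ↦ isUnit_iff_ne_zero.mpr ((map_ne_zero_iff _ (IsFractionRing.injective S L)).mpr
      (nonZeroDivisors.ne_zero (hM y.2)))
  letI : Algebra Sₚ L := (IsLocalization.lift (M := Algebra.algebraMapSubmonoid S p.primeCompl)
    (g := algebraMap S L) hunit).toAlgebra
  haveI : IsScalarTower S Sₚ L := IsScalarTower.of_algebraMap_eq fun s ↦
    (IsLocalization.lift_eq (M := Algebra.algebraMapSubmonoid S p.primeCompl) hunit s).symm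
  haveI : IsFractionRing Sₚ L := IsFractionRing.isFractionRing_of_isDomain_of_isLocalization
    (Algebra.algebraMapSubmonoid S p.primeCompl) Sₚ L
  letI : Algebra Rₚ L := ((algebraMap K L).comp (algebraMap Rₚ K)).toAlgebra
  haveI : IsScalarTower Rₚ K L := IsScalarTower.of_algebraMap_eq fun _ ↦ rfl
  haveI : IsScalarTower Rₚ Sₚ L := by
    refine IsScalarTower.of_algebraMap_eq' ?_
    refine IsLocalization.ringHom_ext p.primeCompl (RingHom.ext fun r ↦ ?_)
    change algebraMap K L (algebraMap Rₚ K (algebraMap R Rₚ r)) =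
      algebraMap Sₚ L (algebraMap Rₚ Sₚ (algebraMap R Rₚ r))
    rw [← IsScalarTower.algebraMap_apply R Rₚ K, ← IsScalarTower.algebraMap_apply R K L,
      ← IsScalarTower.algebraMap_apply R Rₚ Sₚ, IsScalarTower.algebraMap_apply R S Sₚ,
      ← IsScalarTower.algebraMap_apply S Sₚ L, ← IsScalarTower.algebraMap_apply R S L]
  -- Tag 02MJ for `R_𝔭 ⊆ S_𝔭`
  have hb' : algebraMap S Sₚ b ≠ 0 := (map_ne_zero_iff _ (IsLocalization.injective Sₚ hM)).mpr hb
  have H := ordFrac_norm_algebraMap (A := Rₚ) (K := K) (L := L) (algebraMap S Sₚ b) hb'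
  rw [← IsScalarTower.algebraMap_apply S Sₚ L] at H
  rw [H]
  -- reindex the sum by the primes of `S` over `𝔭`
  let e : p.primesOver S ≃ MaximalSpectrum Sₚ :=
    { toFun := fun q ↦ ⟨q.1.map (algebraMap S Sₚ), isMaximal_map p Rₚ Sₚ q.1⟩
      invFun := fun m ↦ ⟨m.asIdeal.under S, inferInstance, ⟨by
        haveI := m.isMaximal
        rw [Ideal.under_under, ← Ideal.under_under (B := Rₚ), under_eq_maximalIdeal m.asIdeal,
          IsLocalization.AtPrime.under_maximalIdeal Rₚ p]⟩⟩
      left_inv := fun q ↦ Subtype.ext (IsLocalization.under_map_of_isPrime_disjoint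
        (Algebra.algebraMapSubmonoid S p.primeCompl) Sₚ q.2.1
        (@Ideal.disjoint_primeCompl_of_liesOver _ _ _ _ _ q.1 p _ q.2.2))
      right_inv := fun m ↦ MaximalSpectrum.ext
        (IsLocalization.map_under (Algebra.algebraMapSubmonoid S p.primeCompl) Sₚ m.asIdeal) }
  have hsum : (∑ᶠ m : MaximalSpectrum Sₚ, (m.asIdeal.inertiaDeg Rₚ : ℕ∞) *
      Ring.ord (Localization.AtPrime m.asIdeal)
        (algebraMap Sₚ (Localization.AtPrime m.asIdeal) (algebraMap S Sₚ b))) =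
      ∑ᶠ q : p.primesOver S, (q.1.inertiaDeg R : ℕ∞) *
        Ring.ord (Localization.AtPrime q.1) (algebraMap S (Localization.AtPrime q.1) b) := by
    rw [← finsum_comp_equiv e]
    refine finsum_congr fun q ↦ ?_
    haveI : (q.1.map (algebraMap S Sₚ)).IsMaximal := isMaximal_map p Rₚ Sₚ q.1
    change ((q.1.map (algebraMap S Sₚ)).inertiaDeg Rₚ : ℕ∞) *
      Ring.ord (Localization.AtPrime (q.1.map (algebraMap S Sₚ)))
        (algebraMap Sₚ (Localization.AtPrime (q.1.map (algebraMap S Sₚ))) (algebraMap S Sₚ b)) = _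
    rw [inertiaDeg_map p Rₚ Sₚ q.1, ← IsScalarTower.algebraMap_apply S Sₚ,
      ord_localization_map p Sₚ q.1 b]
  rw [hsum]

end Extension

end Literature.RingTheory.OrderOfVanishing

end
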